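import Mathlib.Analysis.Calculus.ParametricIntegral
import Mathlib.Analysis.Calculus.IteratedDeriv.Defs
import Mathlib.MeasureTheory.Group.Integral
import Mathlib.MeasureTheory.Constructions.Pi
import Literature.Barriers.CriticalPhenomena.RigorousRGSmallParameterWellPosed
import HarnessLib

/-!
# `RigorousRGSmallParameter` (Slade, Theorem 1.4.1): the susceptibility formula Lemma 8.2.1,
# proved — the bridge from `χ_N` to the renormalisation-group generating function `Z_N`

Third companion ("proof architecture") file of
`Literature/Barriers/CriticalPhenomena/RigorousRGSmallParameter.lean`, one printed layer below
`RigorousRGSmallParameterCriticalPoint.lean`. Source: G. Slade, *Critical exponents for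
long-range `O(n)` models below the upper critical dimension*, CMP 358 (2018), arXiv:1611.06169
(held; page numbers are arXiv PDF pages: §2.1–§2.2 pp. 9–11, §4.1 p. 14, Lemma 8.2.1 p. 36).

## Where this sits in the printed proof

The barrier `RigorousRGSmallParameter` is `LongRangePhi4.Slade2017_thm141` (Theorem 1.4.1, first
display, `n ≥ 1`). The tree proves it from `Slade2017_susceptibilityDiffIneq` (sibling
`…SladeReduction`), which is proved from `Slade2017_criticalCurve` (sibling `…CriticalPoint`,
Theorem 8.3.1): the single unproved input is the renormalisation-group output on the critical
curve, Proposition 8.2.2. The printed proof of Proposition 8.2.2 has two kinds of ingredients: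
(a) **Lemma 8.2.1**, "an elementary formula for `χ̂`": for `n ≥ 0`, `m² > 0`, `g > 0`, `ν₀ ∈ ℝ`,
`χ̂_N(m²,g,ν₀) = 1/m² + (1/m⁴)(1/|Λ_N|) D²Z_N(0;𝟙,𝟙)/Z_N(0)`, where (§4.1)
`g₀ = g`, `ν₀ = ν - m²`, `V_0(φ_x) = g₀τ_x² + ν₀τ_x` (`τ_x = ½|φ_x|²`), `Z_0 = e^{-V_0(Λ_N)}`, `P_C`
is the Gaussian measure "proportional to `e^{-½Σ_iΣ_{x,y}φ_xⁱC⁻¹_{xy}φ_yⁱ}Π_x dφ_x`" with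
`C = ((-Δ_{Λ_N})^{α/2} + m²)⁻¹`, so that `⟨F⟩_{g,ν,N} = E_C F Z_0 / E_C Z_0` ("part of the `τ`
term has been shifted into the Gaussian measure"), `Z_N(φ) = (E_Cθ Z_0)(φ) = E_C Z_0(φ + ζ)`,
`χ̂_N(g,m²,ν₀) = n⁻¹Σ_x E_C((φ_0·φ_x)Z_0)/E_C Z_0` and `χ_N(g, ν₀ + m²) = χ̂_N(m², g, ν₀)`; printed
proof: "By [definition] and symmetry, `χ̂_N = |Λ_N|⁻¹ E_C((𝟙,φ)²Z_0)/Z_N(0)`" with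
`(J,φ) = Σ_x J_xφ_x¹`; `Σ_N(J) = E_C(e^{(J,φ)}Z_0)`; "we combine the exponential arising from the
expectation with the exponential containing the test function, and complete the square …
`-½(φ,C⁻¹φ) + (φ,J) = -½(φ - CJ, C⁻¹(φ - CJ)) + ½(J,CJ)`. Then, by a change of variables,
`Σ_N(J) = e^{½(J,CJ)} Z_N(CJ)`. We differentiate and use the fact that `C𝟙 = m⁻²𝟙`. This leads to
`D²Σ_N(0;𝟙,𝟙) = m⁻²|Λ_N|Z_N(0) + m⁻⁴D²Z_N(0;𝟙,𝟙)`";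
(b) the representation `Z_N = e^{-u_N|Λ|}(I_N + K_N)` and the flow estimates (Theorems 6.3.1,
7.2.2, 7.3.1, Lemmas 8.1.1–8.1.6) — the Bauerschmidt–Brydges–Slade theory proper, stated in the
renormalisation-group coordinates `(g_j, ν_j, K_j)` and the `𝒲_j` norms of [BS-rg-norm],
[BS-rg-step]; these cannot be stated without that framework and are not attempted (triage XL).
The input "`C𝟙 = m⁻²𝟙`" of (a) is the display `((-Δ)^β + m²)⁻¹𝟙 = m⁻²𝟙` of §2.1.2, i.e. (in
`C⁻¹`-form) `(-Δ_Λ)^{α/2}𝟙 = 0`: the generator property of the torus fractional Laplacian, §2.2.2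
("Summability of the right-hand side is guaranteed by Lemma 2.1.1. The fact that `-(-Δ_{Λ_N})^β`
is indeed a generator can be concluded from [the periodisation] and Lemma 2.2.1"), Lemma 2.2.1
being "`(-Δ)^β_{x,x} > 0`, `(-Δ)^β_{x,y} < 0` if `x ≠ y`, and `Σ_y(-Δ)^β_{x,y} = 0`" on `ℤ^d` and
Lemma 2.1.1 the decay `-(-Δ)^β_{0,x} ≍ |x|^{-d-2β}`.

## What this file does (all for the transcribed model of the barrier file)

* `fracLaplacianTorus_eq_tsum_of_rep`, `fracLaplacianTorus_comm`, `fracLaplacianTorus_add` —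
  PROVED: the periodised kernel `((-Δ_Λ)^β)_{x,y} = Σ_z((-Δ_{ℤ^d})^β)_{x̃,ỹ+Mz}` does not depend
  on the representatives ("`x, y` are any fixed representatives", §2.2.2), is symmetric and
  translation invariant (pure reindexing of the `tsum`; no summability needed).
* `potential_translate`, `potential_perm`, `integral_comp_translate`, `integral_comp_perm` —
  PROVED: `V` and Lebesgue measure on `(ℝⁿ)^Λ` are invariant under torus translations and
  permutations of the components (the "symmetry" of the printed proof).
* `sitePotential` (`V_0`), `covInvForm` (`(ζ,C⁻¹ζ)`), `gaussConvZ0` (the UNNORMALISED Gaussian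
  convolution `∫Z_0(ψ+ζ)e^{-½(ζ,C⁻¹ζ)}dζ = (∫e^{-½(ζ,C⁻¹ζ)}dζ)·Z_N(ψ)`; Lemma 8.2.1 only involves
  the normalisation-free ratio `D²Z_N/Z_N`, and the unnormalised form needs no invertibility of
  `C⁻¹`), `unitField` (the direction `𝟙eᵢ`), `fieldSum` (`(𝟙,φⁱ)`), `twoPoint` — definitions,
  with `potential_eq_sitePotential_add_covInvForm`: `V_{g,ν₀+m²} = V_0 + ½(φ,C⁻¹φ)` PROVED.
* `covInvForm_sub_smul_unitField`, `gaussConvZ0_smul_unitField` — PROVED: completing the square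
  and the change of variables, `Ẑ_N(t𝟙eᵢ) = e^{-½t²m²|Λ|}∫e^{tm²(𝟙,φⁱ)}e^{-V}dφ`, given the row
  sums `Σ_y((-Δ_Λ)^{α/2})_{xy} = 0`.
* `hasDerivAt_tilted_integral`, `iteratedDeriv_two_gaussConvZ0` — PROVED: differentiation under
  the integral sign (domination `e^{c|(𝟙,φⁱ)|}e^{-V_{g,ν}} ≤ e^{½|Λ|c²}e^{-V_{g,ν-1}}`, i.e. a
  tilt is absorbed by lowering the mass; `g > 0`), and
  `d²/dt²Ẑ_N(t𝟙eᵢ)|₀ = -m²|Λ|Z + m⁴∫(𝟙,φⁱ)²e^{-V}`.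
* `torusSusceptibility_eq_sum_twoPoint`, `integral_fieldSum_sq` — PROVED: "by definition and
  symmetry", `χ_N = Σ_x⟨φ_0ⁱφ_xⁱ⟩` and `∫(𝟙,φⁱ)²e^{-V} = |Λ|Σ_x∫φ_0ⁱφ_xⁱe^{-V}`.
* `Slade2017_lem821` — **Lemma 8.2.1 PROVED** (hypothesis: the row sums vanish), for every
  torus period `M ≥ 1`, component `i`, `g > 0`, `m² > 0`, `ν₀ ∈ ℝ`.
* `Slade2017_lem211`, `Slade2017_lem221` — Lemmas 2.1.1 and 2.2.1 as named facts (not proved: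
  heat-kernel/subordination analysis on `ℤ^d`), and `fracLaplacianTorus_rowSum_of_lem221` —
  PROVED: the torus row sums vanish given Lemma 2.2.1 (regrouping the absolutely convergent row
  sum along `ℤ^d = ⊔_{y∈Λ}(ỹ + Mℤ^d)`, via the bijection `torusProdSiteEquiv`); whence
  `Slade2017_lem821_of_lem221`: Lemma 8.2.1 from Lemma 2.2.1, for `d ≥ 1`, `α ∈ (0,2)`.

After this file the unproved inputs of `Slade2017_criticalCurve` are `Slade2017_lem221` (with
`Slade2017_lem211` behind the summability that makes the periodised kernel a genuine sum) and the
renormalisation-group theory (b). Not transcribed: `n = 0` (supersymmetric representation); the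
normalised `Z_N`, `Σ_N(J)` for general `J` (only the direction `𝟙` is needed); Lemma 2.2.2.
-/

noncomputable section

namespace Literature.Barriers.CriticalPhenomena

open _root_.MeasureTheory Finset Filter Literature.Probability.LatticeModels
open scoped _root_.Topology BigOperators

namespace LongRangePhi4

variable {d : ℕ}

/-! ### The periodised kernel: choice of representatives, symmetry, translation invariance -/

/-- Shifting the second argument of `(-Δ_{ℤ^d})^β` is the same as shifting the first one
backwards (translation invariance). [cite: Slade2017, §2.1.1] -/
theorem fracLaplacianZd_shift (β : ℝ) (x y v : Site d) :
    fracLaplacianZd d β x (y + v) = fracLaplacianZd d β (x - v) y := by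
  have h := fracLaplacianZd_add d β (x - v) y v
  rwa [sub_add_cancel] at h

/-- Shifting the first argument of `(-Δ_{ℤ^d})^β` is the same as shifting the second one
backwards (translation invariance). [cite: Slade2017, §2.1.1] -/
theorem fracLaplacianZd_shift_left (β : ℝ) (x y v : Site d) :
    fracLaplacianZd d β (x + v) y = fracLaplacianZd d β x (y - v) := by
  have h := fracLaplacianZd_add d β x (y - v) v
  rwa [sub_add_cancel] at h

/-- A representative `r ∈ ℤ^d` of a torus point `x` differs from the `ZMod.val` representative
by a lattice vector `M p`. [folklore] -/
theorem exists_rep_eq_val_add {M : ℕ} [NeZero M] (x : TorusSite d M) (r : Site d)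
    (hr : ∀ j, ((r j : ℤ) : ZMod M) = x j) :
    ∃ p : Site d, ∀ j, r j = ((x j).val : ℤ) + M * p j := by
  refine ⟨fun j => r j / M, fun j => ?_⟩
  have h1 : (((x j).val : ℕ) : ℤ) = r j % M := by
    rw [← hr j, ZMod.val_intCast]
  rw [h1]
  exact (Int.emod_add_mul_ediv (r j) M).symm

/-- "On the right-hand side `x, y` are any fixed representatives": the periodisation
`Σ_{z∈ℤ^d} ((-Δ_{ℤ^d})^β)_{r, s + Mz}` does not depend on the choice of representatives `r, s`
of the torus points `x, y`. [cite: Slade2017, §2.2.2 (torus fractional Laplacian)] -/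
theorem fracLaplacianTorus_eq_tsum_of_rep {M : ℕ} [NeZero M] (β : ℝ) (x y : TorusSite d M)
    (r s : Site d) (hr : ∀ j, ((r j : ℤ) : ZMod M) = x j) (hs : ∀ j, ((s j : ℤ) : ZMod M) = y j) :
    fracLaplacianTorus d β M x y =
      ∑' z : Site d, fracLaplacianZd d β r (fun j => s j + M * z j) := by
  obtain ⟨p, hp⟩ := exists_rep_eq_val_add x r hr
  obtain ⟨q, hq⟩ := exists_rep_eq_val_add y s hs
  unfold fracLaplacianTorus
  -- reindex the left-hand side by `z ↦ z + (q - p)`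
  rw [← (Equiv.addRight (q - p)).tsum_eq]
  refine tsum_congr fun z => ?_
  simp only [Equiv.coe_addRight]
  have e1 : (fun j => s j + (M : ℤ) * z j) =
      (fun j => ((y j).val : ℤ) + (M : ℤ) * (z + (q - p)) j) + fun j => (M : ℤ) * p j := by
    funext j
    simp only [Pi.add_apply, Pi.sub_apply, hq j]
    ring
  have e2 : r = (fun j => ((x j).val : ℤ)) + fun j => (M : ℤ) * p j := by
    funext j
    simp only [Pi.add_apply, hp j]
  rw [e1, e2, fracLaplacianZd_add]

/-- `(-Δ_Λ)^β` is a symmetric kernel on the torus.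
[cite: Slade2017, §1.2 ("real symmetric matrix M")] -/
theorem fracLaplacianTorus_comm {M : ℕ} [NeZero M] (β : ℝ) (x y : TorusSite d M) :
    fracLaplacianTorus d β M x y = fracLaplacianTorus d β M y x := by
  conv_rhs => unfold fracLaplacianTorus
  rw [← (Equiv.neg (Site d)).tsum_eq]
  rw [fracLaplacianTorus_eq_tsum_of_rep β x y (fun j => ((x j).val : ℤ)) (fun j => ((y j).val : ℤ))
    (fun j => by simp) (fun j => by simp)]
  refine tsum_congr fun z => ?_
  rw [fracLaplacianZd_comm]
  simp only [Equiv.neg_apply]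
  have e1 : (fun j => ((y j).val : ℤ) + (M : ℤ) * z j) =
      (fun j => ((y j).val : ℤ)) + fun j => (M : ℤ) * z j := by
    funext j; simp
  rw [e1, fracLaplacianZd_shift_left]
  congr 1
  funext j
  simp only [Pi.sub_apply, Pi.neg_apply]
  ring

/-- `(-Δ_Λ)^β` is translation invariant on the torus. [cite: Slade2017, §2.2.2] -/
theorem fracLaplacianTorus_add {M : ℕ} [NeZero M] (β : ℝ) (x y a : TorusSite d M) :
    fracLaplacianTorus d β M (x + a) (y + a) = fracLaplacianTorus d β M x y := by
  rw [fracLaplacianTorus_eq_tsum_of_rep β (x + a) (y + a)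
    (fun j => ((x j).val : ℤ) + ((a j).val : ℤ)) (fun j => ((y j).val : ℤ) + ((a j).val : ℤ))
    (fun j => by simp) (fun j => by simp)]
  unfold fracLaplacianTorus
  refine tsum_congr fun z => ?_
  have e1 : (fun j => ((x j).val : ℤ) + ((a j).val : ℤ)) =
      (fun j => ((x j).val : ℤ)) + fun j => ((a j).val : ℤ) := by
    funext j; simp
  have e2 : (fun j => ((y j).val : ℤ) + ((a j).val : ℤ) + (M : ℤ) * z j) =
      (fun j => ((y j).val : ℤ) + (M : ℤ) * z j) + fun j => ((a j).val : ℤ) := by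
    funext j; simp only [Pi.add_apply]; ring
  rw [e1, e2, fracLaplacianZd_add]

/-! ### Symmetries of `V`: torus translations and permutations of the components -/

variable {M n : ℕ}

/-- `V` is invariant under torus translations `φ ↦ φ(· + a)`. [cite: Slade2017, §1.2] -/
theorem potential_translate [NeZero M] (α g ν : ℝ) (φ : TorusSite d M → Fin n → ℝ)
    (a : TorusSite d M) :
    potential d M n α g ν (fun x => φ (x + a)) = potential d M n α g ν φ := by
  unfold potential
  have hinner : ∀ (x : TorusSite d M) (i : Fin n),
      ∑ y, fracLaplacianTorus d (α / 2) M x y * φ (y + a) i =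
        ∑ y, fracLaplacianTorus d (α / 2) M (x + a) y * φ y i := by
    intro x i
    rw [← Equiv.sum_comp (Equiv.addRight a)
      (fun y => fracLaplacianTorus d (α / 2) M (x + a) y * φ y i)]
    simp only [Equiv.coe_addRight, fracLaplacianTorus_add]
  simp_rw [hinner]
  exact Equiv.sum_comp (Equiv.addRight a) (fun x => g / 4 * sqNorm (φ x) ^ 2 +
    ν / 2 * sqNorm (φ x) + 1 / 2 * ∑ i, φ x i * ∑ y, fracLaplacianTorus d (α / 2) M x y * φ y i)

/-- `|v ∘ σ|² = |v|²` for a permutation `σ` of the components. [folklore] -/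
theorem sqNorm_comp_perm (σ : Equiv.Perm (Fin n)) (v : Fin n → ℝ) :
    sqNorm (fun i => v (σ i)) = sqNorm v := by
  unfold sqNorm
  exact Equiv.sum_comp σ (fun i => v i ^ 2)

/-- `V` is invariant under a permutation of the `n` components (`O(n)` symmetry restricted to
coordinate permutations). [cite: Slade2017, §1.2] -/
theorem potential_perm [NeZero M] (α g ν : ℝ) (φ : TorusSite d M → Fin n → ℝ)
    (σ : Equiv.Perm (Fin n)) :
    potential d M n α g ν (fun x i => φ x (σ i)) = potential d M n α g ν φ := by
  unfold potential
  refine Finset.sum_congr rfl fun x _ => ?_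
  rw [sqNorm_comp_perm σ (φ x)]
  congr 1
  congr 1
  exact Equiv.sum_comp σ (fun i => φ x i * ∑ y, fracLaplacianTorus d (α / 2) M x y * φ y i)

/-! ### The corresponding symmetries of Lebesgue measure on `(ℝⁿ)^Λ` -/

/-- Lebesgue measure on `(ℝⁿ)^Λ` is invariant under torus translations of the field.
[folklore] -/
theorem integral_comp_translate [NeZero M] (a : TorusSite d M)
    (F : (TorusSite d M → Fin n → ℝ) → ℝ) :
    ∫ φ : TorusSite d M → Fin n → ℝ, F (fun x => φ (x + a)) = ∫ φ, F φ := by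
  have h := volume_preserving_arrowCongr' (β₁ := Fin n → ℝ) (Equiv.subRight a)
    (MeasurableEquiv.refl (Fin n → ℝ)) (MeasurePreserving.id volume)
  rw [← h.integral_comp' F]
  rfl

/-- Lebesgue measure on `(ℝⁿ)^Λ` is invariant under a permutation of the components of the
field. [folklore] -/
theorem integral_comp_perm [NeZero M] (σ : Equiv.Perm (Fin n))
    (F : (TorusSite d M → Fin n → ℝ) → ℝ) :
    ∫ φ : TorusSite d M → Fin n → ℝ, F (fun x i => φ x (σ i)) = ∫ φ, F φ := by
  have hβ := volume_preserving_arrowCongr' (β₁ := ℝ) σ.symm (MeasurableEquiv.refl ℝ)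
    (MeasurePreserving.id volume)
  have h := volume_preserving_arrowCongr' (Equiv.refl (TorusSite d M))
    (MeasurableEquiv.arrowCongr' σ.symm (MeasurableEquiv.refl ℝ)) hβ
  rw [← h.integral_comp' F]
  rfl

/-- Unnormalised expectations `∫ F e^{-V}` are invariant under torus translations.
[cite: Slade2017, §1.2] -/
theorem integral_mul_exp_neg_potential_translate [NeZero M] (α g ν : ℝ) (a : TorusSite d M)
    (F : (TorusSite d M → Fin n → ℝ) → ℝ) :
    ∫ φ : TorusSite d M → Fin n → ℝ, F (fun x => φ (x + a)) * Real.exp (-potential d M n α g ν φ) =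
      ∫ φ, F φ * Real.exp (-potential d M n α g ν φ) := by
  have h := integral_comp_translate (n := n) a
    (fun φ => F φ * Real.exp (-potential d M n α g ν φ))
  simp only [potential_translate] at h
  exact h

/-- Unnormalised expectations `∫ F e^{-V}` are invariant under permutations of the components.
[cite: Slade2017, §1.2] -/
theorem integral_mul_exp_neg_potential_perm [NeZero M] (α g ν : ℝ) (σ : Equiv.Perm (Fin n))
    (F : (TorusSite d M → Fin n → ℝ) → ℝ) :
    ∫ φ : TorusSite d M → Fin n → ℝ,
        F (fun x i => φ x (σ i)) * Real.exp (-potential d M n α g ν φ) =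
      ∫ φ, F φ * Real.exp (-potential d M n α g ν φ) := by
  have h := integral_comp_perm (M := M) σ
    (fun φ => F φ * Real.exp (-potential d M n α g ν φ))
  simp only [potential_perm] at h
  exact h

/-! ### `V = V_0 + ½(φ, C⁻¹φ)`: the Gaussian part of the measure (Slade §4.1) -/

/-- `V_0(φ) = Σ_{x∈Λ} (g_0 τ_x² + ν_0 τ_x)` with `τ_x = ½|φ_x|²`, `g_0 = g` (Slade §4.1, the
definition of `V_0` and `Z_0 = e^{-V_0}`): the single-site part of `V`, i.e. `V` at mass `ν₀`
without the interaction. [cite: Slade2017, §4.1 (definition of V_0 and Z_0)] -/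
def sitePotential [NeZero M] (g ν₀ : ℝ) (φ : TorusSite d M → Fin n → ℝ) : ℝ :=
  ∑ x, (g / 4 * sqNorm (φ x) ^ 2 + ν₀ / 2 * sqNorm (φ x))

/-- The quadratic form of `C⁻¹ = (-Δ_Λ)^{α/2} + m²` acting diagonally on the components:
`Σ_{i=1}^n Σ_{x,y∈Λ} ζ_xⁱ C⁻¹_{xy} ζ_yⁱ` (Slade §4.1: "`P_C` is proportional to
`e^{-½ Σ_i Σ_{x,y} φ_xⁱ C⁻¹_{xy} φ_yⁱ} Π_x dφ_x`", with "`C = ((-Δ_{Λ_N})^{α/2} + m²)⁻¹`").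
Written with the matrix `C⁻¹`, so that no inverse is taken.
[cite: Slade2017, §4.1 (Gaussian measure P_C)] -/
def covInvForm (d M n : ℕ) [NeZero M] (α m2 : ℝ) (ζ : TorusSite d M → Fin n → ℝ) : ℝ :=
  ∑ x, ∑ i, ζ x i * (∑ y, fracLaplacianTorus d (α / 2) M x y * ζ y i + m2 * ζ x i)

/-- The Gaussian convolution `(E_C θ Z_0)(ψ) = E_C Z_0(ψ + ζ)` of Slade §4.1 ("`Z_N(φ) =
(E_Cθ Z_0)(φ) = E_C Z_0(φ + ζ)`"), UNNORMALISED: `Ẑ_N(ψ) = ∫ e^{-V_0(ψ+ζ)} e^{-½(ζ,C⁻¹ζ)} dζ`, so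
that `Z_N = Ẑ_N / ∫ e^{-½(ζ,C⁻¹ζ)}dζ` whenever the Gaussian normalisation is finite; the ratio
`D²Z_N(0;𝟙,𝟙)/Z_N(0)` of Lemma 8.2.1 does not see the normalisation.
[cite: Slade2017, §4.1 (definition of Z_N)] -/
def gaussConvZ0 (d M n : ℕ) [NeZero M] (α g ν₀ m2 : ℝ) (ψ : TorusSite d M → Fin n → ℝ) : ℝ :=
  ∫ ζ : TorusSite d M → Fin n → ℝ,
    Real.exp (-sitePotential g ν₀ (ψ + ζ)) * Real.exp (-(covInvForm d M n α m2 ζ / 2))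

/-- The constant test function `𝟙` (`𝟙_x = 1`) placed in the component `i` of field space: the
direction `x ↦ e_i` (the proof of Lemma 8.2.1 pairs test functions with the first component,
"`(J,φ) = Σ_{x∈Λ} J_xφ_x¹`"; any fixed component will do). [cite: Slade2017, Lemma 8.2.1 (proof)] -/
def unitField (d M n : ℕ) (i : Fin n) : TorusSite d M → Fin n → ℝ :=
  fun _ j => if j = i then 1 else 0

/-- `(𝟙, φⁱ) = Σ_{x∈Λ} φ_xⁱ`. [cite: Slade2017, Lemma 8.2.1 (proof)] -/
def fieldSum [NeZero M] (i : Fin n) (φ : TorusSite d M → Fin n → ℝ) : ℝ := ∑ x, φ x i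

/-- `V_{g, ν₀+m²} = V_0 + ½ Σ_i (φⁱ, ((-Δ_Λ)^{α/2} + m²)φⁱ)`: "part of the `τ` term has been
shifted into the Gaussian measure" (Slade §4.1, `g_0 = g`, `ν_0 = ν - m²`).
[cite: Slade2017, §4.1 (display ⟨F⟩_{g,ν,N} = E_C F Z_0 / E_C Z_0)] -/
theorem potential_eq_sitePotential_add_covInvForm [NeZero M] (α g ν₀ m2 : ℝ)
    (φ : TorusSite d M → Fin n → ℝ) :
    potential d M n α g (ν₀ + m2) φ = sitePotential g ν₀ φ + covInvForm d M n α m2 φ / 2 := by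
  unfold potential sitePotential covInvForm
  rw [Finset.sum_div, ← Finset.sum_add_distrib]
  refine Finset.sum_congr rfl fun x _ => ?_
  have h : ∑ i, φ x i * (∑ y, fracLaplacianTorus d (α / 2) M x y * φ y i + m2 * φ x i) =
      ∑ i, φ x i * ∑ y, fracLaplacianTorus d (α / 2) M x y * φ y i + m2 * sqNorm (φ x) := by
    unfold sqNorm
    rw [Finset.mul_sum, ← Finset.sum_add_distrib]
    refine Finset.sum_congr rfl fun i _ => ?_
    ring
  rw [h]
  ring

/-- The interaction form `Σ_x v_x Σ_y K_{xy} v_y` is unchanged by a constant shift of `v` when the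
kernel `K = (-Δ_Λ)^{α/2}` has vanishing row sums (it is symmetric, so its column sums vanish
too): `(v - c𝟙, K(v - c𝟙)) = (v, Kv)`. [cite: Slade2017, §2.2.2 and Lemma 2.2.1] -/
theorem interaction_shift_const [NeZero M] (β : ℝ)
    (hrow : ∀ x : TorusSite d M, ∑ y, fracLaplacianTorus d β M x y = 0)
    (v : TorusSite d M → ℝ) (c : ℝ) :
    ∑ x, (v x - c) * ∑ y, fracLaplacianTorus d β M x y * (v y - c) =
      ∑ x, v x * ∑ y, fracLaplacianTorus d β M x y * v y := by
  have hcol : ∀ y : TorusSite d M, ∑ x, fracLaplacianTorus d β M x y = 0 := by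
    intro y
    simp_rw [fracLaplacianTorus_comm β _ y]
    exact hrow y
  have h1 : ∀ x, ∑ y, fracLaplacianTorus d β M x y * (v y - c) =
      ∑ y, fracLaplacianTorus d β M x y * v y := by
    intro x
    simp_rw [mul_sub, Finset.sum_sub_distrib, ← Finset.sum_mul, hrow x]
    ring
  simp_rw [h1, sub_mul, Finset.sum_sub_distrib]
  have h2 : ∑ x, c * ∑ y, fracLaplacianTorus d β M x y * v y = 0 := by
    rw [← Finset.mul_sum, Finset.sum_comm]
    simp_rw [← Finset.sum_mul]
    simp [hcol]
  rw [h2, sub_zero]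

/-! ### Domination: exponential tilts by `(𝟙, φⁱ)` against `e^{-V}` -/

/-- Lowering the mass by one absorbs a Gaussian factor: `V_{g,ν} = V_{g,ν-1} + ½Σ_x|φ_x|²`.
[folklore] -/
theorem potential_mass_shift [NeZero M] (α g ν : ℝ) (φ : TorusSite d M → Fin n → ℝ) :
    potential d M n α g ν φ = potential d M n α g (ν - 1) φ + (1 / 2) * ∑ x, sqNorm (φ x) := by
  unfold potential
  rw [Finset.mul_sum, ← Finset.sum_add_distrib]
  refine Finset.sum_congr rfl fun x _ => ?_
  ring

/-- `(𝟙, φⁱ)` is continuous in the field. [folklore] -/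
theorem continuous_fieldSum [NeZero M] (i : Fin n) :
    Continuous (fieldSum (d := d) (M := M) i) := by
  unfold fieldSum
  fun_prop

/-- `c|(𝟙,φⁱ)| ≤ ½|Λ|c² + ½Σ_x|φ_x|²` (from `c|φ_xⁱ| ≤ ½c² + ½(φ_xⁱ)²`). [folklore] -/
theorem mul_abs_fieldSum_le [NeZero M] (i : Fin n) (c : ℝ) (φ : TorusSite d M → Fin n → ℝ) :
    c * |fieldSum i φ| ≤
      Fintype.card (TorusSite d M) * c ^ 2 / 2 + (1 / 2) * ∑ x, sqNorm (φ x) := by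
  unfold fieldSum
  have h1 : c * |∑ x, φ x i| ≤ ∑ x : TorusSite d M, (c ^ 2 / 2 + (φ x i) ^ 2 / 2) := by
    calc c * |∑ x, φ x i| ≤ |c| * ∑ x, |φ x i| :=
          (mul_le_mul_of_nonneg_right (le_abs_self c) (abs_nonneg _)).trans
            (mul_le_mul_of_nonneg_left (Finset.abs_sum_le_sum_abs _ _) (abs_nonneg c))
      _ = ∑ x, |c| * |φ x i| := Finset.mul_sum _ _ _
      _ ≤ ∑ x, (c ^ 2 / 2 + (φ x i) ^ 2 / 2) := Finset.sum_le_sum fun x _ => by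
          nlinarith [sq_nonneg (|c| - |φ x i|), sq_abs c, sq_abs (φ x i)]
  have h2 : ∀ x : TorusSite d M, (φ x i) ^ 2 ≤ sqNorm (φ x) := fun x =>
    Finset.single_le_sum (fun j _ => sq_nonneg (φ x j)) (Finset.mem_univ i)
  calc c * |∑ x, φ x i| ≤ ∑ x : TorusSite d M, (c ^ 2 / 2 + (φ x i) ^ 2 / 2) := h1
    _ ≤ ∑ x : TorusSite d M, (c ^ 2 / 2 + sqNorm (φ x) / 2) :=
        Finset.sum_le_sum fun x _ => by linarith [h2 x]
    _ = Fintype.card (TorusSite d M) * c ^ 2 / 2 + (1 / 2) * ∑ x, sqNorm (φ x) := by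
        rw [Finset.sum_add_distrib, Finset.sum_const, Finset.card_univ, nsmul_eq_mul,
          Finset.mul_sum]
        congr 1
        · ring
        · exact Finset.sum_congr rfl fun x _ => by ring

/-- **Domination of exponential tilts.**
`e^{c|(𝟙,φⁱ)|}e^{-V_{g,ν}(φ)} ≤ e^{½|Λ|c²}e^{-V_{g,ν-1}(φ)}`: a tilt of the Gibbs weight by
`e^{c|Σ_xφ_xⁱ|}` is absorbed by lowering the mass. [folklore] -/
theorem exp_mul_abs_fieldSum_mul_exp_neg_potential_le [NeZero M] (i : Fin n) (α g ν c : ℝ)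
    (φ : TorusSite d M → Fin n → ℝ) :
    Real.exp (c * |fieldSum i φ|) * Real.exp (-potential d M n α g ν φ) ≤
      Real.exp (Fintype.card (TorusSite d M) * c ^ 2 / 2) *
        Real.exp (-potential d M n α g (ν - 1) φ) := by
  rw [← Real.exp_add, ← Real.exp_add, Real.exp_le_exp, potential_mass_shift α g ν φ]
  linarith [mul_abs_fieldSum_le i c φ]

/-- Any continuous `Φ` with `|Φ| ≤ A e^{c|(𝟙,φⁱ)|} e^{-V_{g,ν}}` is Lebesgue integrable (`g > 0`).
[folklore] -/
theorem integrable_of_abs_le_exp_fieldSum [NeZero M] (i : Fin n) {α g ν : ℝ} (hg : 0 < g)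
    (A c : ℝ) {Φ : (TorusSite d M → Fin n → ℝ) → ℝ} (hΦ : Continuous Φ)
    (hle : ∀ φ, |Φ φ| ≤ A * (Real.exp (c * |fieldSum i φ|) * Real.exp (-potential d M n α g ν φ))) :
    Integrable Φ := by
  refine (((integrable_exp_neg_potential (d := d) (M := M) (n := n) (α := α) (ν := ν - 1)
    hg).const_mul (Real.exp (Fintype.card (TorusSite d M) * c ^ 2 / 2))).const_mul |A|).mono'
    hΦ.aestronglyMeasurable (Filter.Eventually.of_forall fun φ => ?_)
  rw [Real.norm_eq_abs]
  calc |Φ φ| ≤ A * (Real.exp (c * |fieldSum i φ|) * Real.exp (-potential d M n α g ν φ)) := hle φ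
    _ ≤ |A| * (Real.exp (c * |fieldSum i φ|) * Real.exp (-potential d M n α g ν φ)) :=
        mul_le_mul_of_nonneg_right (le_abs_self A) (by positivity)
    _ ≤ |A| * (Real.exp (Fintype.card (TorusSite d M) * c ^ 2 / 2) *
          Real.exp (-potential d M n α g (ν - 1) φ)) :=
        mul_le_mul_of_nonneg_left (exp_mul_abs_fieldSum_mul_exp_neg_potential_le i α g ν c φ)
          (abs_nonneg A)

/-- **Differentiation under the integral sign for the tilted partition function.** For `g > 0`
and every `k`, `t ↦ ∫ (a(𝟙,φⁱ))^k e^{ta(𝟙,φⁱ)} e^{-V(φ)} dφ` has derivative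
`∫ (a(𝟙,φⁱ))^{k+1} e^{ta(𝟙,φⁱ)} e^{-V(φ)} dφ` (dominated differentiation; the domination is
`exp_mul_abs_fieldSum_mul_exp_neg_potential_le`). [folklore] -/
theorem hasDerivAt_tilted_integral [NeZero M] (i : Fin n) {α g ν : ℝ} (hg : 0 < g) (a : ℝ)
    (k : ℕ) (t₀ : ℝ) :
    HasDerivAt (fun t : ℝ => ∫ φ : TorusSite d M → Fin n → ℝ,
        (a * fieldSum i φ) ^ k * Real.exp (t * (a * fieldSum i φ)) *
          Real.exp (-potential d M n α g ν φ))
      (∫ φ : TorusSite d M → Fin n → ℝ,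
        (a * fieldSum i φ) ^ (k + 1) * Real.exp (t₀ * (a * fieldSum i φ)) *
          Real.exp (-potential d M n α g ν φ)) t₀ := by
  set F : ℝ → (TorusSite d M → Fin n → ℝ) → ℝ := fun t φ =>
    (a * fieldSum i φ) ^ k * Real.exp (t * (a * fieldSum i φ)) *
      Real.exp (-potential d M n α g ν φ) with hF
  set F' : ℝ → (TorusSite d M → Fin n → ℝ) → ℝ := fun t φ =>
    (a * fieldSum i φ) ^ (k + 1) * Real.exp (t * (a * fieldSum i φ)) *
      Real.exp (-potential d M n α g ν φ) with hF'
  have hcontS := continuous_fieldSum (d := d) (M := M) i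
  have hcontV := continuous_potential (d := d) (M := M) (n := n) α g ν
  have hFcont : ∀ t, Continuous (F t) := fun t => by
    simp only [hF]
    fun_prop
  have hF'cont : ∀ t, Continuous (F' t) := fun t => by
    simp only [hF']
    fun_prop
  -- pointwise bounds: `|aS|^j e^{t aS} ≤ j! e^{(|t|+1)|a||S|}`
  have hpow : ∀ (j : ℕ) (t : ℝ) (φ : TorusSite d M → Fin n → ℝ),
      |(a * fieldSum i φ) ^ j * Real.exp (t * (a * fieldSum i φ))| ≤
        (Nat.factorial j : ℝ) * Real.exp ((|t| + 1) * |a| * |fieldSum i φ|) := by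
    intro j t φ
    have hx : 0 ≤ |a * fieldSum i φ| := abs_nonneg _
    have h1 : |a * fieldSum i φ| ^ j ≤ (Nat.factorial j : ℝ) * Real.exp |a * fieldSum i φ| := by
      have := Real.pow_div_factorial_le_exp _ hx j
      rw [div_le_iff₀ (by positivity)] at this
      linarith
    have h2 : Real.exp (t * (a * fieldSum i φ)) ≤ Real.exp (|t| * |a * fieldSum i φ|) := by
      rw [Real.exp_le_exp, ← abs_mul]
      exact le_abs_self _
    rw [abs_mul, abs_pow, Real.abs_exp]
    calc |a * fieldSum i φ| ^ j * Real.exp (t * (a * fieldSum i φ))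
        ≤ (Nat.factorial j : ℝ) * Real.exp |a * fieldSum i φ| *
            Real.exp (|t| * |a * fieldSum i φ|) :=
          mul_le_mul h1 h2 (Real.exp_pos _).le (by positivity)
      _ = (Nat.factorial j : ℝ) * Real.exp ((|t| + 1) * |a| * |fieldSum i φ|) := by
          rw [mul_assoc, ← Real.exp_add, abs_mul]
          congr 2
          ring
  have hFint : ∀ t, Integrable (F t) := by
    intro t
    refine integrable_of_abs_le_exp_fieldSum (α := α) (ν := ν) i hg (Nat.factorial k)
      ((|t| + 1) * |a|) (hFcont t) fun φ => ?_
    simp only [hF]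
    rw [abs_mul, Real.abs_exp]
    calc |(a * fieldSum i φ) ^ k * Real.exp (t * (a * fieldSum i φ))| *
          Real.exp (-potential d M n α g ν φ)
        ≤ (Nat.factorial k : ℝ) * Real.exp ((|t| + 1) * |a| * |fieldSum i φ|) *
          Real.exp (-potential d M n α g ν φ) :=
          mul_le_mul_of_nonneg_right (hpow k t φ) (Real.exp_pos _).le
      _ = _ := mul_assoc _ _ _
  have key := hasDerivAt_integral_of_dominated_loc_of_deriv_le (μ := volume) (F := F) (F' := F')
    (x₀ := t₀) (bound := fun φ => (Nat.factorial (k + 1) : ℝ) *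
      (Real.exp ((|t₀| + 1 + 1) * |a| * |fieldSum i φ|) * Real.exp (-potential d M n α g ν φ)))
    (Metric.ball_mem_nhds t₀ one_pos)
    (Filter.Eventually.of_forall fun t => (hFcont t).aestronglyMeasurable) (hFint t₀)
    (hF'cont t₀).aestronglyMeasurable ?_ ?_ ?_
  · exact key.2
  · -- the bound on the derivative over the ball
    refine Filter.Eventually.of_forall fun φ t ht => ?_
    rw [Real.norm_eq_abs]
    simp only [hF']
    rw [abs_mul, Real.abs_exp]
    have ht' : |t| ≤ |t₀| + 1 := by
      have := Metric.mem_ball.1 ht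
      rw [Real.dist_eq] at this
      linarith [abs_sub_abs_le_abs_sub t t₀]
    calc |(a * fieldSum i φ) ^ (k + 1) * Real.exp (t * (a * fieldSum i φ))| *
          Real.exp (-potential d M n α g ν φ)
        ≤ (Nat.factorial (k + 1) : ℝ) * Real.exp ((|t| + 1) * |a| * |fieldSum i φ|) *
          Real.exp (-potential d M n α g ν φ) :=
          mul_le_mul_of_nonneg_right (hpow (k + 1) t φ) (Real.exp_pos _).le
      _ ≤ (Nat.factorial (k + 1) : ℝ) * Real.exp ((|t₀| + 1 + 1) * |a| * |fieldSum i φ|) *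
          Real.exp (-potential d M n α g ν φ) := by
          gcongr
      _ = _ := mul_assoc _ _ _
  · -- integrability of the bound
    refine integrable_of_abs_le_exp_fieldSum (α := α) (ν := ν) i hg (Nat.factorial (k + 1))
      ((|t₀| + 1 + 1) * |a|) (by fun_prop) fun φ => le_of_eq ?_
    rw [abs_of_nonneg (by positivity)]
  · -- pointwise differentiability
    refine Filter.Eventually.of_forall fun φ t _ => ?_
    simp only [hF, hF']
    have h := (((hasDerivAt_mul_const (a * fieldSum i φ)).exp (x := t)).const_mul
      ((a * fieldSum i φ) ^ k)).mul_const (Real.exp (-potential d M n α g ν φ))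
    refine h.congr_deriv ?_
    ring

/-! ### Completing the square (proof of Lemma 8.2.1) -/

/-- `(ζ, C⁻¹ζ) = Σ_i (ζⁱ, (-Δ_Λ)^{α/2}ζⁱ) + m² Σ_x|ζ_x|²`. [cite: Slade2017, §4.1] -/
theorem covInvForm_eq [NeZero M] (α m2 : ℝ) (ζ : TorusSite d M → Fin n → ℝ) :
    covInvForm d M n α m2 ζ =
      (∑ j, ∑ x, ζ x j * ∑ y, fracLaplacianTorus d (α / 2) M x y * ζ y j) +
        m2 * ∑ x, sqNorm (ζ x) := by
  unfold covInvForm sqNorm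
  have h : ∀ x : TorusSite d M,
      ∑ j, ζ x j * (∑ y, fracLaplacianTorus d (α / 2) M x y * ζ y j + m2 * ζ x j) =
        ∑ j, ζ x j * ∑ y, fracLaplacianTorus d (α / 2) M x y * ζ y j + m2 * ∑ j, ζ x j ^ 2 := by
    intro x
    rw [Finset.mul_sum, ← Finset.sum_add_distrib]
    exact Finset.sum_congr rfl fun j _ => by ring
  simp_rw [h]
  rw [Finset.sum_add_distrib, ← Finset.mul_sum]
  congr 1
  exact Finset.sum_comm

/-- **Completing the square, the quadratic form.** Shifting the field by `t𝟙` in component `i`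
changes `(ζ, C⁻¹ζ)` only through the mass term, because `(-Δ_Λ)^{α/2}𝟙 = 0`:
`(φ - t𝟙eᵢ, C⁻¹(φ - t𝟙eᵢ)) = (φ, C⁻¹φ) - 2tm²(𝟙,φⁱ) + t²m²|Λ|` — this is "`C𝟙 = m⁻²𝟙`"
(the display `((-Δ)^β + m²)⁻¹𝟙 = m⁻²𝟙` of §2.1.2) used in the proof of Lemma 8.2.1, in
`C⁻¹`-form. [cite: Slade2017, Lemma 8.2.1 (proof) and §2.1.2] -/
theorem covInvForm_sub_smul_unitField [NeZero M] {α : ℝ} (m2 : ℝ) (i : Fin n)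
    (hrow : ∀ x : TorusSite d M, ∑ y, fracLaplacianTorus d (α / 2) M x y = 0)
    (φ : TorusSite d M → Fin n → ℝ) (t : ℝ) :
    covInvForm d M n α m2 (φ - t • unitField d M n i) =
      covInvForm d M n α m2 φ - 2 * t * m2 * fieldSum i φ +
        t ^ 2 * m2 * Fintype.card (TorusSite d M) := by
  rw [covInvForm_eq, covInvForm_eq]
  have hcomp : ∀ (x : TorusSite d M) (j : Fin n),
      (φ - t • unitField d M n i) x j = φ x j - t * (if j = i then 1 else 0) := by
    intro x j
    simp [unitField]
  simp_rw [hcomp]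
  -- the interaction part is unchanged, component by component
  have hint : ∀ j : Fin n,
      ∑ x, (φ x j - t * (if j = i then 1 else 0)) *
          ∑ y, fracLaplacianTorus d (α / 2) M x y * (φ y j - t * (if j = i then 1 else 0)) =
        ∑ x, φ x j * ∑ y, fracLaplacianTorus d (α / 2) M x y * φ y j :=
    fun j => interaction_shift_const (α / 2) hrow (fun x => φ x j) _
  simp_rw [hint]
  -- the mass part
  have hmass : ∀ x : TorusSite d M,
      sqNorm (fun j => φ x j - t * (if j = i then 1 else 0)) =
        sqNorm (φ x) - 2 * t * φ x i + t ^ 2 := by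
    intro x
    unfold sqNorm
    have e : ∀ j : Fin n, (φ x j - t * (if j = i then 1 else 0)) ^ 2 =
        φ x j ^ 2 + (if j = i then -2 * t * φ x j + t ^ 2 else 0) := by
      intro j
      split_ifs <;> ring
    simp_rw [e]
    rw [Finset.sum_add_distrib, Finset.sum_ite_eq' Finset.univ i, if_pos (Finset.mem_univ i)]
    ring
  have hmass' : ∑ x : TorusSite d M, sqNorm (fun j => φ x j - t * (if j = i then 1 else 0)) =
      ∑ x, sqNorm (φ x) - 2 * t * fieldSum i φ + t ^ 2 * Fintype.card (TorusSite d M) := by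
    simp_rw [hmass]
    rw [Finset.sum_add_distrib, Finset.sum_sub_distrib, Finset.sum_const, Finset.card_univ,
      nsmul_eq_mul, fieldSum, Finset.mul_sum]
    ring
  -- `sqNorm ((φ - t•u) x)` is `sqNorm (fun j => …)`
  have hcompx : ∀ x : TorusSite d M,
      (φ - t • unitField d M n i) x = fun j => φ x j - t * (if j = i then 1 else 0) := by
    intro x
    funext j
    exact hcomp x j
  simp_rw [hcompx]
  rw [hmass']
  ring

/-- **Completing the square** (Slade, proof of Lemma 8.2.1: "we combine the exponential arising
from the expectation with the exponential containing the test function, and complete the square …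
Then, by a change of variables"): along the direction `𝟙eᵢ`,
`Ẑ_N(t𝟙eᵢ) = e^{-½t²m²|Λ|} ∫ e^{tm²(𝟙,φⁱ)} e^{-V_{g,ν₀+m²}(φ)} dφ`
(translation invariance of Lebesgue measure and `covInvForm_sub_smul_unitField`).
[cite: Slade2017, Lemma 8.2.1 (proof)] -/
theorem gaussConvZ0_smul_unitField [NeZero M] (i : Fin n) (α g ν₀ m2 : ℝ)
    (hrow : ∀ x : TorusSite d M, ∑ y, fracLaplacianTorus d (α / 2) M x y = 0) (t : ℝ) :
    gaussConvZ0 d M n α g ν₀ m2 (t • unitField d M n i) =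
      Real.exp (-(t ^ 2 * m2 * Fintype.card (TorusSite d M) / 2)) *
        ∫ φ : TorusSite d M → Fin n → ℝ, Real.exp (t * (m2 * fieldSum i φ)) *
          Real.exp (-potential d M n α g (ν₀ + m2) φ) := by
  unfold gaussConvZ0
  rw [← integral_sub_right_eq_self _ (t • unitField d M n i), ← integral_const_mul]
  refine integral_congr_ae (Filter.Eventually.of_forall fun φ => ?_)
  simp only [add_sub_cancel]
  rw [covInvForm_sub_smul_unitField m2 i hrow φ t, ← Real.exp_add, ← Real.exp_add,
    ← Real.exp_add, potential_eq_sitePotential_add_covInvForm]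
  congr 1
  ring

/-- The first two `t`-derivatives of `Ẑ_N(t𝟙eᵢ)` exist and
`d²/dt² Ẑ_N(t𝟙eᵢ)|_{t=0} = -m²|Λ| Z + m⁴ ∫ (𝟙,φⁱ)² e^{-V}`, `Z = ∫e^{-V}`, `V = V_{g,ν₀+m²}`
(Slade: "We differentiate and use the fact that `C𝟙 = m⁻²𝟙`. This leads to
`D²Σ_N(0;𝟙,𝟙) = m⁻²|Λ_N|Z_N(0) + m⁻⁴D²Z_N(0;𝟙,𝟙)`", here in the unnormalised form and solved
for `D²Z_N`). [cite: Slade2017, Lemma 8.2.1 (proof)] -/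
theorem iteratedDeriv_two_gaussConvZ0 [NeZero M] (i : Fin n) {α g ν₀ m2 : ℝ} (hg : 0 < g)
    (hrow : ∀ x : TorusSite d M, ∑ y, fracLaplacianTorus d (α / 2) M x y = 0) :
    iteratedDeriv 2 (fun t : ℝ => gaussConvZ0 d M n α g ν₀ m2 (t • unitField d M n i)) 0 =
      -(m2 * Fintype.card (TorusSite d M)) *
          (∫ φ : TorusSite d M → Fin n → ℝ, Real.exp (-potential d M n α g (ν₀ + m2) φ)) +
        ∫ φ : TorusSite d M → Fin n → ℝ,
          (m2 * fieldSum i φ) ^ 2 * Real.exp (-potential d M n α g (ν₀ + m2) φ) := by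
  set N : ℝ := (Fintype.card (TorusSite d M) : ℝ) with hN
  set V : (TorusSite d M → Fin n → ℝ) → ℝ := potential d M n α g (ν₀ + m2) with hV
  set G : ℕ → ℝ → ℝ := fun k t => ∫ φ : TorusSite d M → Fin n → ℝ,
    (m2 * fieldSum i φ) ^ k * Real.exp (t * (m2 * fieldSum i φ)) * Real.exp (-V φ) with hG
  have hGd : ∀ (k : ℕ) (t : ℝ), HasDerivAt (G k) (G (k + 1) t) t := fun k t =>
    hasDerivAt_tilted_integral i hg m2 k t
  set c : ℝ := -(m2 * N / 2) with hc
  set h : ℝ → ℝ := fun t => Real.exp (t ^ 2 * c) with hh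
  have hhd : ∀ t, HasDerivAt h (-(t * (m2 * N)) * h t) t := by
    intro t
    have h1 := ((hasDerivAt_pow 2 t).mul_const c).exp
    refine h1.congr_deriv ?_
    simp only [hh, hc, Nat.cast_ofNat, Nat.add_one_sub_one, pow_one]
    ring
  have hf : (fun t : ℝ => gaussConvZ0 d M n α g ν₀ m2 (t • unitField d M n i)) =
      fun t => h t * G 0 t := by
    funext t
    rw [gaussConvZ0_smul_unitField i α g ν₀ m2 hrow t]
    simp only [hh, hG, hV, hN, hc]
    congr 1
    · congr 1
      ring
    · congr 1
      funext φ
      rw [pow_zero, one_mul]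
  rw [hf, iteratedDeriv_succ, iteratedDeriv_one]
  have hd1 : deriv (fun t => h t * G 0 t) =
      fun t => -(t * (m2 * N)) * h t * G 0 t + h t * G 1 t := by
    funext t
    exact ((hhd t).fun_mul (hGd 0 t)).deriv
  rw [hd1]
  have hlin : ∀ t, HasDerivAt (fun t : ℝ => -(t * (m2 * N))) (-(m2 * N)) t := fun t =>
    (hasDerivAt_mul_const (m2 * N)).fun_neg
  have hd2 := (((hlin 0).fun_mul (hhd 0)).fun_mul (hGd 0 0)).fun_add ((hhd 0).fun_mul (hGd 1 0))
  rw [hd2.deriv]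
  have h0 : h 0 = 1 := by simp [hh]
  simp only [h0, hG, hV, zero_mul, neg_zero, mul_one, one_mul, mul_zero, add_zero, zero_add,
    pow_zero, pow_one, Real.exp_zero]

/-! ### The susceptibility as `|Λ|⁻¹⟨(𝟙,φⁱ)²⟩` ("by definition and symmetry") -/

/-- The unnormalised two-point function `∫ φ_xʲ φ_yʲ e^{-V(φ)} dφ`. [cite: Slade2017, §1.2] -/
def twoPoint (d M n : ℕ) [NeZero M] (α g ν : ℝ) (x y : TorusSite d M) (j : Fin n) : ℝ :=
  ∫ φ : TorusSite d M → Fin n → ℝ, φ x j * φ y j * Real.exp (-potential d M n α g ν φ)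

/-- `φ ↦ φ_xʲφ_yʲe^{-V(φ)}` is Lebesgue integrable (`g > 0`). [folklore] -/
theorem integrable_twoPoint_integrand [NeZero M] {α g ν : ℝ} (hg : 0 < g) (x y : TorusSite d M)
    (j : Fin n) :
    Integrable (fun φ : TorusSite d M → Fin n → ℝ =>
      φ x j * φ y j * Real.exp (-potential d M n α g ν φ)) := by
  refine integrable_mul_exp_neg_potential hg (by fun_prop) fun φ => ?_
  have hx : φ x j ^ 2 ≤ sqNorm (φ x) :=
    Finset.single_le_sum (fun k _ => sq_nonneg (φ x k)) (Finset.mem_univ j)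
  have hy : φ y j ^ 2 ≤ sqNorm (φ y) :=
    Finset.single_le_sum (fun k _ => sq_nonneg (φ y k)) (Finset.mem_univ j)
  have hx' : sqNorm (φ x) ≤ ∑ z, sqNorm (φ z) :=
    Finset.single_le_sum (fun z _ => sqNorm_nonneg (φ z)) (Finset.mem_univ x)
  have hy' : sqNorm (φ y) ≤ ∑ z, sqNorm (φ z) :=
    Finset.single_le_sum (fun z _ => sqNorm_nonneg (φ z)) (Finset.mem_univ y)
  have h2 : |φ x j * φ y j| ≤ (φ x j ^ 2 + φ y j ^ 2) / 2 := by
    rw [abs_le]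
    constructor <;> nlinarith [sq_nonneg (φ x j + φ y j), sq_nonneg (φ x j - φ y j)]
  linarith

/-- Translation invariance of the two-point function: `⟨φ_xʲφ_yʲ⟩ = ⟨φ_0ʲφ_{y-x}ʲ⟩`.
[cite: Slade2017, §1.2] -/
theorem twoPoint_translate [NeZero M] (α g ν : ℝ) (x y : TorusSite d M) (j : Fin n) :
    twoPoint d M n α g ν x y j = twoPoint d M n α g ν 0 (y - x) j := by
  unfold twoPoint
  rw [← integral_mul_exp_neg_potential_translate α g ν x (fun φ => φ 0 j * φ (y - x) j)]
  simp only [zero_add, sub_add_cancel]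

/-- `O(n)` symmetry of the two-point function: `⟨φ_xʲφ_yʲ⟩` does not depend on the component `j`.
[cite: Slade2017, §1.2] -/
theorem twoPoint_comp [NeZero M] (α g ν : ℝ) (x y : TorusSite d M) (i j : Fin n) :
    twoPoint d M n α g ν x y j = twoPoint d M n α g ν x y i := by
  unfold twoPoint
  rw [← integral_mul_exp_neg_potential_perm α g ν (Equiv.swap i j) (fun φ => φ x i * φ y i)]
  simp only [Equiv.swap_apply_left]

/-- **"By definition and symmetry"** (first display in the proof of Lemma 8.2.1):
`χ_N(g,ν) = n⁻¹Σ_x⟨φ_0·φ_x⟩ = Σ_x ∫φ_0ⁱφ_xⁱe^{-V} / ∫e^{-V}` for any fixed component `i`.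
[cite: Slade2017, Lemma 8.2.1 (proof, first display)] -/
theorem torusSusceptibility_eq_sum_twoPoint [NeZero M] {α g ν : ℝ} (hg : 0 < g) (i : Fin n) :
    torusSusceptibility d M n α g ν =
      (∑ x, twoPoint d M n α g ν 0 x i) / ∫ φ, Real.exp (-potential d M n α g ν φ) := by
  have hn : (n : ℝ) ≠ 0 := by exact_mod_cast (Fin.pos i).ne'
  unfold torusSusceptibility
  simp_rw [expect_eq_integral_div, Finset.sum_mul]
  have hsum : ∀ x : TorusSite d M,
      ∫ φ : TorusSite d M → Fin n → ℝ, ∑ j, φ 0 j * φ x j * Real.exp (-potential d M n α g ν φ) =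
        n * twoPoint d M n α g ν 0 x i := by
    intro x
    rw [integral_finsetSum _ fun j _ => integrable_twoPoint_integrand hg 0 x j]
    have : ∀ j : Fin n, ∫ φ : TorusSite d M → Fin n → ℝ,
        φ 0 j * φ x j * Real.exp (-potential d M n α g ν φ) = twoPoint d M n α g ν 0 x i :=
      fun j => twoPoint_comp α g ν 0 x i j
    simp_rw [this]
    rw [Finset.sum_const, Finset.card_univ, Fintype.card_fin, nsmul_eq_mul]
  simp_rw [hsum, ← Finset.sum_div, ← Finset.mul_sum]
  field_simp

/-- `∫ (𝟙,φⁱ)² e^{-V} = |Λ| Σ_x ∫ φ_0ⁱφ_xⁱ e^{-V}` (expand the square, translation invariance).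
[cite: Slade2017, Lemma 8.2.1 (proof, first display)] -/
theorem integral_fieldSum_sq [NeZero M] {α g ν : ℝ} (hg : 0 < g) (i : Fin n) :
    ∫ φ : TorusSite d M → Fin n → ℝ, fieldSum i φ ^ 2 * Real.exp (-potential d M n α g ν φ) =
      Fintype.card (TorusSite d M) * ∑ x, twoPoint d M n α g ν 0 x i := by
  unfold fieldSum
  have hexp : ∀ φ : TorusSite d M → Fin n → ℝ,
      (∑ x, φ x i) ^ 2 * Real.exp (-potential d M n α g ν φ) =
        ∑ x, ∑ y, φ x i * φ y i * Real.exp (-potential d M n α g ν φ) := by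
    intro φ
    rw [sq, Finset.sum_mul_sum, Finset.sum_mul]
    refine Finset.sum_congr rfl fun x _ => ?_
    rw [Finset.sum_mul]
  simp_rw [hexp]
  rw [integral_finsetSum _ fun x _ => (integrable_finsetSum _ fun y _ =>
    integrable_twoPoint_integrand hg x y i)]
  have hin : ∀ x : TorusSite d M,
      ∫ φ : TorusSite d M → Fin n → ℝ, ∑ y, φ x i * φ y i * Real.exp (-potential d M n α g ν φ) =
        ∑ y, twoPoint d M n α g ν 0 y i := by
    intro x
    rw [integral_finsetSum _ fun y _ => integrable_twoPoint_integrand hg x y i]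
    rw [← Equiv.sum_comp (Equiv.subRight x) (fun y => twoPoint d M n α g ν 0 y i)]
    simp only [Equiv.subRight_apply]
    refine Finset.sum_congr rfl fun y _ => ?_
    rw [← twoPoint, twoPoint_translate]
  simp_rw [hin]
  rw [Finset.sum_const, Finset.card_univ, nsmul_eq_mul]

/-! ### Lemma 8.2.1 -/

/-- **Slade, Lemma 8.2.1** (the susceptibility in terms of the renormalisation-group
generating function), for the transcribed model and any period `M` of the torus:
for `n ≥ 1` (a component `i` is fixed; the paper takes the first), `m² > 0`, `g > 0`, `ν₀ ∈ ℝ`,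
`χ̂_N(m², g, ν₀) := χ_N(g, ν₀ + m²) = 1/m² + (1/m⁴)(1/|Λ_N|) D²Z_N(0;𝟙,𝟙)/Z_N(0)`,
where `Z_N = E_Cθ Z_0` is the Gaussian convolution of `Z_0 = e^{-V_0}` with covariance
`C = ((-Δ_Λ)^{α/2} + m²)⁻¹` (§4.1) and `D²Z_N(0;𝟙,𝟙) = d²/dt² Z_N(t𝟙)|_{t=0}` is the second
directional derivative along the constant test function in the chosen component. Here `Z_N` is
the UNNORMALISED convolution `gaussConvZ0` (the ratio is normalisation-free) and `χ_N` is
`torusSusceptibility` (`n⁻¹Σ_x⟨φ_0·φ_x⟩_{g,ν,N}`, §1.2). The hypothesis `hrow` is the generator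
property `Σ_y ((-Δ_Λ)^{α/2})_{xy} = 0` of the torus fractional Laplacian (§2.2.2 with Lemma
2.2.1, resting on the summability Lemma 2.1.1; derived from the named fact `Slade2017_lem221`
in `fracLaplacianTorus_rowSum_of_lem221` below), which is exactly the printed input
"`C𝟙 = m⁻²𝟙`". Proof as printed: complete the square,
change variables (translation invariance of `dφ`), differentiate twice under the integral.
[cite: Slade2017, Lemma 8.2.1] -/
theorem Slade2017_lem821 [NeZero M] (i : Fin n) {α g ν₀ m2 : ℝ} (hg : 0 < g) (hm2 : 0 < m2)
    (hrow : ∀ x : TorusSite d M, ∑ y, fracLaplacianTorus d (α / 2) M x y = 0) :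
    torusSusceptibility d M n α g (ν₀ + m2) =
      1 / m2 + 1 / m2 ^ 2 * (1 / Fintype.card (TorusSite d M)) *
        (iteratedDeriv 2 (fun t : ℝ => gaussConvZ0 d M n α g ν₀ m2 (t • unitField d M n i)) 0 /
          gaussConvZ0 d M n α g ν₀ m2 0) := by
  set Z : ℝ := ∫ φ : TorusSite d M → Fin n → ℝ, Real.exp (-potential d M n α g (ν₀ + m2) φ)
    with hZ
  have hZpos : 0 < Z := integral_exp_pos (integrable_exp_neg_potential hg)
  have hN : (0 : ℝ) < Fintype.card (TorusSite d M) := by exact_mod_cast Fintype.card_pos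
  have hZ0 : gaussConvZ0 d M n α g ν₀ m2 0 = Z := by
    have h := gaussConvZ0_smul_unitField i α g ν₀ m2 hrow 0
    rw [zero_smul] at h
    rw [h, hZ]
    simp
  rw [hZ0, iteratedDeriv_two_gaussConvZ0 i hg hrow, torusSusceptibility_eq_sum_twoPoint hg i]
  have hsq : ∫ φ : TorusSite d M → Fin n → ℝ,
      (m2 * fieldSum i φ) ^ 2 * Real.exp (-potential d M n α g (ν₀ + m2) φ) =
        m2 ^ 2 * (Fintype.card (TorusSite d M) * ∑ x, twoPoint d M n α g (ν₀ + m2) 0 x i) := by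
    rw [← integral_fieldSum_sq hg i, ← integral_const_mul]
    refine integral_congr_ae (Filter.Eventually.of_forall fun φ => ?_)
    simp only
    ring
  rw [hsq, ← hZ]
  field_simp
  ring

/-- Lemma 8.2.1 along the tori `Λ_N = (ℤ/L^Nℤ)^d` of the barrier file (`torusSusceptibilityPow`,
the sequence whose limit is `HasSusceptibility`): the paper's `χ_N(g, ν₀+m²) = χ̂_N(m², g, ν₀)`.
[cite: Slade2017, Lemma 8.2.1 and §8.2 (first display)] -/
theorem Slade2017_lem821_pow {L : ℕ} [NeZero L] (N : ℕ) (i : Fin n) {α g ν₀ m2 : ℝ}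
    (hg : 0 < g) (hm2 : 0 < m2)
    (hrow : ∀ x : TorusSite d (L ^ N), ∑ y, fracLaplacianTorus d (α / 2) (L ^ N) x y = 0) :
    torusSusceptibilityPow d L N n α g (ν₀ + m2) =
      1 / m2 + 1 / m2 ^ 2 * (1 / Fintype.card (TorusSite d (L ^ N))) *
        (iteratedDeriv 2
            (fun t : ℝ => gaussConvZ0 d (L ^ N) n α g ν₀ m2 (t • unitField d (L ^ N) n i)) 0 /
          gaussConvZ0 d (L ^ N) n α g ν₀ m2 0) := by
  unfold torusSusceptibilityPow
  rw [dif_neg (NeZero.ne L)]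
  exact Slade2017_lem821 i hg hm2 hrow

/-! ### The input `(-Δ_Λ)^{α/2}𝟙 = 0`: Lemmas 2.1.1, 2.2.1 (named facts) and the torus row sums -/

/-- **Slade, Lemma 2.1.1** (decay of the fractional Laplacian kernel; named fact, not proved
here — the printed proof is the subordination formula `λ^β = c∫₀^∞(1 - e^{-tλ})t^{-1-β}dt` fed with
Gaussian heat-kernel bounds for the continuous-time simple random walk [GT02]): "For `d ≥ 1` and
`β ∈ (0,1)`, as `|x| → ∞`, `-(-Δ)^β_{0,x} ≍ |x|^{-d-2β}`", with "`a ≍ b` denotes the existence of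
`c > 0` such that `c⁻¹b ≤ a ≤ cb`" (§1.2); `|x|` the Euclidean norm on `ℤ^d`, "as `|x| → ∞`"
rendered as "for all `x` with `|x| ≥ R`". [cite: Slade2017, Lemma 2.1.1] -/
def Slade2017_lem211 : Prop :=
  ∀ (d : ℕ), 1 ≤ d → ∀ β : ℝ, 0 < β → β < 1 →
    ∃ c R : ℝ, 0 < c ∧ ∀ x : Site d, R ≤ Real.sqrt (∑ j, ((x j : ℤ) : ℝ) ^ 2) →
      c⁻¹ * Real.sqrt (∑ j, ((x j : ℤ) : ℝ) ^ 2) ^ (-((d : ℝ) + 2 * β)) ≤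
          -fracLaplacianZd d β 0 x ∧
        -fracLaplacianZd d β 0 x ≤ c * Real.sqrt (∑ j, ((x j : ℤ) : ℝ) ^ 2) ^ (-((d : ℝ) + 2 * β))

/-- **Slade, Lemma 2.2.1** (`-(-Δ)^β` generates a Markov chain on `ℤ^d`; named fact, not proved
here — printed proof: the binomial series `(-Δ)^β = (2d)^β Σ_n (-1)ⁿ (β choose n) (J/2d)ⁿ` and
`Σ_n (-1)ⁿ(β choose n) = (1-1)^β = 0`): "For `d ≥ 1` and `β ∈ (0,1)`, `(-Δ)^β_{x,x} > 0`,
`(-Δ)^β_{x,y} < 0` if `x ≠ y`, and `Σ_y (-Δ)^β_{x,y} = 0`." The row sum over `y ∈ ℤ^d` is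
absolutely convergent by Lemma 2.1.1; it is rendered as `HasSum … 0`.
[cite: Slade2017, Lemma 2.2.1] -/
def Slade2017_lem221 : Prop :=
  ∀ (d : ℕ), 1 ≤ d → ∀ β : ℝ, 0 < β → β < 1 → ∀ x : Site d,
    0 < fracLaplacianZd d β x x ∧ (∀ y : Site d, y ≠ x → fracLaplacianZd d β x y < 0) ∧
      HasSum (fun y : Site d => fracLaplacianZd d β x y) 0

/-- One coordinate of the identification `Λ × ℤ^d ≃ ℤ^d`, `(y, z) ↦ ỹ + Mz` with `ỹ` the
`ZMod.val` representative. [folklore] -/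
def zmodProdIntEquiv (M : ℕ) [NeZero M] : ZMod M × ℤ ≃ ℤ where
  toFun p := (p.1.val : ℤ) + M * p.2
  invFun w := ((w : ZMod M), w / M)
  left_inv := by
    rintro ⟨a, k⟩
    have hM : (M : ℤ) ≠ 0 := by exact_mod_cast NeZero.ne M
    simp only [Prod.mk.injEq]
    constructor
    · push_cast
      rw [ZMod.natCast_zmod_val, ZMod.natCast_self, zero_mul, add_zero]
    · rw [Int.add_mul_ediv_left _ _ hM, Int.ediv_eq_zero_of_lt (by positivity)
        (by exact_mod_cast ZMod.val_lt a), zero_add]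
  right_inv w := by
    simp only [ZMod.val_intCast]
    exact Int.emod_add_mul_ediv w M

/-- The identification `Λ_N × ℤ^d ≃ ℤ^d`, `(y, z) ↦ ỹ + Mz` (every lattice point is a unique
representative-plus-period). [folklore] -/
def torusProdSiteEquiv (d M : ℕ) [NeZero M] : TorusSite d M × Site d ≃ Site d where
  toFun p := fun j => zmodProdIntEquiv M (p.1 j, p.2 j)
  invFun w :=
    (fun j => ((zmodProdIntEquiv M).symm (w j)).1, fun j => ((zmodProdIntEquiv M).symm (w j)).2)
  left_inv := by
    rintro ⟨y, z⟩
    simp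
  right_inv w := by
    funext j
    simp

/-- `(y, z) ↦ ỹ + Mz` on the nose. [folklore] -/
theorem torusProdSiteEquiv_apply {M : ℕ} [NeZero M] (y : TorusSite d M) (z : Site d) :
    torusProdSiteEquiv d M (y, z) = fun j => ((y j).val : ℤ) + M * z j := rfl

/-- **The torus fractional Laplacian has vanishing row sums** ("The fact that `-(-Δ_{Λ_N})^β`
is indeed a generator can be concluded from [the periodisation formula] and Lemma 2.2.1",
§2.2.2), PROVED from Lemma 2.2.1: regroup the absolutely convergent row sum over `ℤ^d` along
`ℤ^d = ⊔_{y∈Λ} (ỹ + Mℤ^d)`. Valid for every period `M ≥ 1` (the paper's `M = L^N`).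
[cite: Slade2017, §2.2.2 (torus generator) and Lemma 2.2.1] -/
theorem fracLaplacianTorus_rowSum_of_lem221 (h : Slade2017_lem221) {d : ℕ} (hd : 1 ≤ d)
    {β : ℝ} (hβ0 : 0 < β) (hβ1 : β < 1) {M : ℕ} [NeZero M] (x : TorusSite d M) :
    ∑ y, fracLaplacianTorus d β M x y = 0 := by
  obtain ⟨-, -, hsum⟩ := h d hd β hβ0 hβ1 (fun j => ((x j).val : ℤ))
  set e := torusProdSiteEquiv d M with he
  have h1 : HasSum (fun p : TorusSite d M × Site d =>
      fracLaplacianZd d β (fun j => ((x j).val : ℤ)) (e p)) 0 :=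
    (e.hasSum_iff (f := fun w : Site d => fracLaplacianZd d β (fun j => ((x j).val : ℤ)) w)).2 hsum
  have h2 : ∀ y : TorusSite d M, HasSum (fun z : Site d =>
        fracLaplacianZd d β (fun j => ((x j).val : ℤ)) (e (y, z)))
      (fracLaplacianTorus d β M x y) := by
    intro y
    have hs : Summable (fun z : Site d =>
        fracLaplacianZd d β (fun j => ((x j).val : ℤ)) (e (y, z))) :=
      h1.summable.comp_injective (Prod.mk_right_injective y)
    have heq : fracLaplacianTorus d β M x y =
        ∑' z : Site d, fracLaplacianZd d β (fun j => ((x j).val : ℤ)) (e (y, z)) := by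
      simp only [he, torusProdSiteEquiv_apply]
      rfl
    rw [heq]
    exact hs.hasSum
  have h3 := h1.prod_fiberwise h2
  exact (hasSum_fintype _).unique h3

/-- **Lemma 8.2.1 with its printed input.** Given Lemma 2.2.1 (`Slade2017_lem221`), the
susceptibility formula holds for the long-range model with `α ∈ (0,2)` on any torus of dimension
`d ≥ 1`. [cite: Slade2017, Lemma 8.2.1 and Lemma 2.2.1] -/
theorem Slade2017_lem821_of_lem221 (h : Slade2017_lem221) {d M n : ℕ} [NeZero M] (hd : 1 ≤ d)
    (i : Fin n) {α g ν₀ m2 : ℝ} (hα0 : 0 < α) (hα2 : α < 2) (hg : 0 < g) (hm2 : 0 < m2) :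
    torusSusceptibility d M n α g (ν₀ + m2) =
      1 / m2 + 1 / m2 ^ 2 * (1 / Fintype.card (TorusSite d M)) *
        (iteratedDeriv 2 (fun t : ℝ => gaussConvZ0 d M n α g ν₀ m2 (t • unitField d M n i)) 0 /
          gaussConvZ0 d M n α g ν₀ m2 0) :=
  Slade2017_lem821 i hg hm2
    (fracLaplacianTorus_rowSum_of_lem221 h hd (by positivity) (by linarith))

end LongRangePhi4

end Literature.Barriers.CriticalPhenomena

end
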